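import Mathlib
import HarnessLib
import Summits.HubbardSuperconductivity.HubbardSuperconductivity.Theorems.KLProgrammeKLRegimeWickOrderedStep
import Summits.HubbardSuperconductivity.HubbardSuperconductivity.Theorems.KLProgrammeKLRegimeSplitThermalLayer

/-!
# Route `KLProgramme` — crux K3, gen-4 ENGINE child `KLRegimeEngineV12` (stmt-HubbardSuperconductivity-19855): the WICK-ORDERED
# CARRIERS — twins of the D1 / V2 / V3 value and kernel carriers on the soft-smeared action `𝒲_n = e^{Δ_{D_n}}𝒱_n`, and
# «the end product is unchanged»: `𝒲_n = 𝒱_n` at and below the temperature scale (cell gate-hubbard-kl, seat p1 g8)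

Statements-first vocabulary for the GEN-LEDGER candidate «E2-STRUCTURE / Wick value carriers» (HOME/p1/E2-STRUCTURE-NOTE.md §5 (B);
STATUS p1 g8 01:5xZ): every value / kernel carrier the V12 clauses read on the PLAIN action `klEffectiveAction … n` gets a twin on
`klWickAction … n` (p481972), with the SAME label tuples, truncations and sector families, so that a Wick-valued clause text is the
V12 text with one token changed.  Nothing here asserts anything about the model; the one theorem with content is elementary:

* §1 values: `klWickPairArray` (the Wick pair amplitude truncated to the ball, twin of `klPairArray`), `klWickQuarticValue` (twin of
  `klQuarticValue`, BGM field order), `klWickSelfEnergy` (twin of `klSelfEnergy`);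
* §2 kernels: `klWickLegKernel` / `klWickAnisoLegKernel` (isotropic and anisotropic sectorised `m`-leg kernels of `𝒲_n`, twins of D1's
  `klLegKernel` / `klAnisoLegKernel`), `klWickIsoKernelAt n m` / `klWickAnisoKernelAt n m` (the quartic Wick kernel sectorised at resolution
  `m`, twins of V2's `klIsoKernelAt` / `klAnisoKernelAt`), `klWickAnisoLegKernelNorm` (twin of `klAnisoLegKernelNorm`);
* §3 **`klw_softCov_eq_zero_of_lt`**: `D_n = 0` once `Λ_n ≤ π/β` (temperature is an infrared cutoff: `hubbardCovAboveCT_eq_of_le`), hence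
  **`klw_wickAction_eq_effectiveAction_of_lt`**: `𝒲_n = 𝒱_n` for `nScales β < n` — at the last scale of the ladder (`n = nScales β + 1`,
  where K3's two-point output is read) the Wick and the plain scheme COINCIDE; value/kernel corollaries `klWickPairAmplitude_eq_of_lt` etc.

References: HOME/p1/E2-STRUCTURE-NOTE.md; M. Salmhofer, *Renormalization* (1999) §2.2–2.3, §4.3; D1 `…SectorisedLegKernelsDefs`
(p418698), V2 `…SplitPredicatesV2`, V3 `…SplitPredicatesV3`.
-/

noncomputable section

namespace Summit.HubbardSuperconductivity.HubbardSuperconductivity.Theorems.KLRegimeWick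

set_option linter.dupNamespace false -- summit = problem name (single-conjunct summit), D-0017

open Real Finset Literature.MathematicalPhysics.QuantumLattice Literature.Probability.LatticeModels
open Summit.HubbardSuperconductivity.HubbardSuperconductivity.Theorems.KLProgrammeLegKernels
open Summit.HubbardSuperconductivity.HubbardSuperconductivity.Theorems.KLRegimeSplit

section Model

variable (L M : ℕ) [NeZero L] [NeZero M]

/-! ## §1 Value carriers on the Wick-smeared action -/

/-- **The scale-`n` Wick pair array at total momentum `Q`, truncated to the ball** (twin of `klPairArray`). -/
def klWickPairArray (β U μ : ℝ) (K : TrigPolyC4v) (n : ℕ) (Q : TorusSite 2 L) : Matrix (TorusSite 2 L) (TorusSite 2 L) ℂ :=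
  Matrix.of fun k k' => if k ∈ klBall L μ K ∧ k' ∈ klBall L μ K then klWickPairAmplitude L M β U μ K n Q k k' else 0

/-- **The Wick running coupling value** `λ^{W,σσ'}_n(k₁,k₂,k₃)` in BGM's field order (twin of `klQuarticValue`: same label tuple on `𝒲_n`). -/
def klWickQuarticValue (β U μ : ℝ) (K : TrigPolyC4v) (n : ℕ) (σ σ' : Fin 2) (k₁ k₂ k₃ : TorusSite 2 L) : ℂ :=
  vertexFn L M β (klWickAction L M β U μ K n) 4
    ![(((omega0 M, k₁), σ), 0), (((omega0 M, k₂), σ), 1), ((((omega0 M).rev, k₃), σ'), 0),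
      ((((omega0 M).rev, k₁ - k₂ + k₃), σ'), 1)]

/-- **The Wick self-energy** of the scale-`n` action (twin of `klSelfEnergy`; differs from it by the soft Hartree-type
self-contractions of the higher Wick kernels). -/
def klWickSelfEnergy (β U μ : ℝ) (K : TrigPolyC4v) (n : ℕ) (k : FreqMomentum L M) (σ : Fin 2) : ℂ :=
  selfEnergy L M β (klWickAction L M β U μ K n) k σ

/-! ## §2 Kernel carriers on the Wick-smeared action -/

/-- The isotropic-sectorised `m`-leg kernels of `𝒲_n` (twin of D1's `klLegKernel … n m`). -/
def klWickLegKernel (β U μ : ℝ) (K : TrigPolyC4v) (n m : ℕ) :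
    (Fin m → SectorLeg (sectorCount (2 * n))) → (Fin m → SpaceTimeIdx L M) → ℂ :=
  sectorisedKernel L M β (klIsoFamily L M β μ K klE0 n) (klWickAction L M β U μ K n) m

/-- The anisotropic-sectorised `m`-leg kernels of `𝒲_n` (twin of D1's `klAnisoLegKernel … n m`). -/
def klWickAnisoLegKernel (β U μ : ℝ) (K : TrigPolyC4v) (n m : ℕ) :
    (Fin m → SectorLeg (sectorCount n)) → (Fin m → SpaceTimeIdx L M) → ℂ :=
  sectorisedKernel L M β (klAnisoFamily L M β μ K klE0 n) (klWickAction L M β U μ K n) m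

/-- The sectorised `L¹–L^∞` norm of the anisotropic `m`-leg Wick kernels (twin of `klAnisoLegKernelNorm`; the (E1) carrier). -/
def klWickAnisoLegKernelNorm (β U μ : ℝ) (K : TrigPolyC4v) (n m : ℕ) : ℝ :=
  hubbardSectorKernelNorm L M β (klAnisoFamily L M β μ K klE0 n)
    (bgmSectorSet L M (klAnisoFamily L M β μ K klE0 n) m) (klWickAction L M β U μ K n)

/-- The quartic Wick kernel of scale `n` sectorised at isotropic resolution `m` (twin of V2's `klIsoKernelAt`; the (E5-S) carrier). -/
def klWickIsoKernelAt (β U μ : ℝ) (K : TrigPolyC4v) (n m : ℕ) :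
    (Fin 4 → SectorLeg (sectorCount (2 * m))) → (Fin 4 → SpaceTimeIdx L M) → ℂ :=
  sectorisedKernel L M β (klIsoFamily L M β μ K klE0 m) (klWickAction L M β U μ K n) 4

/-- The quartic Wick kernel of scale `n` sectorised at anisotropic resolution `m` (twin of V2's `klAnisoKernelAt`). -/
def klWickAnisoKernelAt (β U μ : ℝ) (K : TrigPolyC4v) (n m : ℕ) :
    (Fin 4 → SectorLeg (sectorCount m)) → (Fin 4 → SpaceTimeIdx L M) → ℂ :=
  sectorisedKernel L M β (klAnisoFamily L M β μ K klE0 m) (klWickAction L M β U μ K n) 4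

variable (β U μ : ℝ) (K : TrigPolyC4v)

/-- Entries of the truncated Wick pair array. -/
theorem klWickPairArray_apply (n : ℕ) (Q k k' : TorusSite 2 L) :
    klWickPairArray L M β U μ K n Q k k' =
      if k ∈ klBall L μ K ∧ k' ∈ klBall L μ K then klWickPairAmplitude L M β U μ K n Q k k' else 0 := rfl

/-- On the ball the truncated array is the amplitude. -/
theorem klWickPairArray_apply_of_mem (n : ℕ) (Q : TorusSite 2 L) {k k' : TorusSite 2 L} (hk : k ∈ klBall L μ K)
    (hk' : k' ∈ klBall L μ K) : klWickPairArray L M β U μ K n Q k k' = klWickPairAmplitude L M β U μ K n Q k k' := by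
  rw [klWickPairArray_apply, if_pos ⟨hk, hk'⟩]

/-! ## §3 At and below the temperature scale the Wick and the plain scheme coincide -/

omit [NeZero L] [NeZero M] in
/-- **Temperature is an infrared cutoff**: the soft covariance vanishes once `Λ_n ≤ π/β`. -/
theorem klw_softCov_eq_zero_of_le {β : ℝ} (hβ : 0 < β) {n : ℕ} (hn : klScale klE0 n ≤ Real.pi / β) (μ : ℝ) (K : TrigPolyC4v) :
    klSoftCov L M β μ K n = 0 := by
  rw [klSoftCov, hubbardCovBelowCT, hubbardCovAboveCT_eq_of_le L M hβ (klth_klScale_pos n) hn μ 0 K, sub_self]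

omit [NeZero L] [NeZero M] in
/-- … in particular for every scale index beyond the thermal one, `nScales β < n`. -/
theorem klw_softCov_eq_zero_of_lt {β : ℝ} (hβ : 0 < β) {n : ℕ} (hn : nScales β < n) (μ : ℝ) (K : TrigPolyC4v) :
    klSoftCov L M β μ K n = 0 :=
  klw_softCov_eq_zero_of_le L M hβ (klth_klScale_lt_pi_div hβ hn).le μ K

omit [NeZero M] in
/-- **`𝒲_n = 𝒱_n` at and below the temperature scale**: the END PRODUCT of the ladder (read at `n = nScales β + 1`) is the same in
the Wick and in the plain scheme. -/
theorem klw_wickAction_eq_effectiveAction_of_lt {β : ℝ} (hβ : 0 < β) (U μ : ℝ) (K : TrigPolyC4v) {n : ℕ} (hn : nScales β < n) :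
    klWickAction L M β U μ K n = klEffectiveAction L M β U μ K klE0 n := by
  rw [klWickAction, klw_softCov_eq_zero_of_lt L M hβ hn, gaussConv_zero, Module.End.one_apply]

/-- The Wick and the plain pair amplitude coincide beyond the thermal scale. -/
theorem klWickPairAmplitude_eq_of_lt {β : ℝ} (hβ : 0 < β) (U μ : ℝ) (K : TrigPolyC4v) {n : ℕ} (hn : nScales β < n)
    (Q k k' : TorusSite 2 L) : klWickPairAmplitude L M β U μ K n Q k k' = klPairAmplitude L M β U μ K n Q k k' := by
  rw [klWickPairAmplitude, klPairAmplitude, klw_wickAction_eq_effectiveAction_of_lt L M hβ U μ K hn]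

/-- The Wick and the plain pair ARRAY coincide beyond the thermal scale. -/
theorem klWickPairArray_eq_of_lt {β : ℝ} (hβ : 0 < β) (U μ : ℝ) (K : TrigPolyC4v) {n : ℕ} (hn : nScales β < n)
    (Q : TorusSite 2 L) : klWickPairArray L M β U μ K n Q = klPairArray L M β U μ K n Q := by
  ext k k'
  rw [klWickPairArray_apply, klPairArray, Matrix.of_apply, klWickPairAmplitude_eq_of_lt L M hβ U μ K hn]

/-- The Wick and the plain running coupling values coincide beyond the thermal scale. -/
theorem klWickQuarticValue_eq_of_lt {β : ℝ} (hβ : 0 < β) (U μ : ℝ) (K : TrigPolyC4v) {n : ℕ} (hn : nScales β < n)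
    (σ σ' : Fin 2) (k₁ k₂ k₃ : TorusSite 2 L) :
    klWickQuarticValue L M β U μ K n σ σ' k₁ k₂ k₃ = klQuarticValue L M β U μ K n σ σ' k₁ k₂ k₃ := by
  rw [klWickQuarticValue, klQuarticValue, klw_wickAction_eq_effectiveAction_of_lt L M hβ U μ K hn]

omit [NeZero M] in
/-- The Wick and the plain self-energy coincide beyond the thermal scale. -/
theorem klWickSelfEnergy_eq_of_lt {β : ℝ} (hβ : 0 < β) (U μ : ℝ) (K : TrigPolyC4v) {n : ℕ} (hn : nScales β < n)
    (k : FreqMomentum L M) (σ : Fin 2) : klWickSelfEnergy L M β U μ K n k σ = klSelfEnergy L M β U μ K klE0 n k σ := by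
  rw [klWickSelfEnergy, klSelfEnergy, klw_wickAction_eq_effectiveAction_of_lt L M hβ U μ K hn]

omit [NeZero M] in
/-- The Wick and the plain anisotropic leg kernels coincide beyond the thermal scale. -/
theorem klWickAnisoLegKernel_eq_of_lt {β : ℝ} (hβ : 0 < β) (U μ : ℝ) (K : TrigPolyC4v) {n : ℕ} (hn : nScales β < n) (m : ℕ) :
    klWickAnisoLegKernel L M β U μ K n m = klAnisoLegKernel L M β U μ K klE0 n m := by
  rw [klWickAnisoLegKernel, klAnisoLegKernel, klw_wickAction_eq_effectiveAction_of_lt L M hβ U μ K hn]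

omit [NeZero M] in
/-- At scale `0` nothing is smeared away only if `Λ₀ ≤ π/β`; in general `𝒲₀ = e^{Δ_{D₀}}V_K`-type data differ from the plain ones —
recorded here only as the unfolding of `klWickAction 0`. -/
theorem klWickAction_zero (U μ : ℝ) (K : TrigPolyC4v) :
    klWickAction L M β U μ K 0 = gaussConv ℂ (klSoftCov L M β μ K 0) (klEffectiveAction L M β U μ K klE0 0) := rfl

end Model

end Summit.HubbardSuperconductivity.HubbardSuperconductivity.Theorems.KLRegimeWick

end
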